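import Literature.AlgebraicGeometry.Resolution.AlterationsMultisectionLocalStepProofs
import Literature.AlgebraicGeometry.Resolution.AlterationsMultisectionEtaleNhdLemmas
import Literature.AlgebraicGeometry.Resolution.EtaleOverNhd
import Literature.AlgebraicGeometry.Resolution.EtaleNhdOfFlatUnramifiedPoint
import Literature.AlgebraicGeometry.Resolution.ResidueFieldsIntegralMorphisms
import Literature.AlgebraicGeometry.Motives.FiberStalk
import HarnessLib

/-!
# De Jong's alteration theorem: `f|_H` is étale over a neighbourhood of `y` — PROVED (de Jong 1996, proof of 4.13)

Topic: `Literature/AlgebraicGeometry/Resolution`. Discharge of the named fact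
`DeJong1996MultisectionEtaleNhd` of `AlterationsMultisectionLocalStep.lean`, the middle input of
the local step of de Jong 1996, Lemma 4.13:

> "At each of the intersection points `x ∈ f⁻¹(y) ∩ H` we have `Ô_{X,x} ≅ Ô_{Y,y}[[t]]` since
> `f` is smooth at `x`. Further `H` is defined by `(h) ⊂ 𝒪_{X,x}` with
> `h ∈ t + 𝔪_{Y,y}Ô_{X,x}`, as `H ∩ f⁻¹(y)` [is reduced]. Therefore `f|_H : H → Y` is finite étale
> over a neighbourhood of `y` in `Y`." (p. 70)

The formal proof replaces the completions by the flat-plus-unramified characterisation of étale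
morphisms (EGA IV₄ 17.6.1) and the slicing criterion for flatness (EGA IV₃ 11.3.8 = Matsumura's
Corollary to Thm. 22.5, proved in `FlatSlicingCriterion.lean`). For a point `z ∈ H = V(I)` over
the closed point `y`, with image `x ∈ X` and local rings `A = 𝒪_{Y,y} → B = 𝒪_{X,x} ↠ C = 𝒪_{H,z}`
(`C = B/I_x`, `I_x = (h)` a local equation of the Cartier divisor):

* **flat.** `B` is flat over `A` (`x ∈ sm(X/Y)`, `flat_stalkMap_of_mem_smoothLocus`). The image
  `h̄` of `h` in `B̄ = B/𝔪_A B = 𝒪_{X_y,x}` is a non-zero-divisor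
  (`quotient_mk_mem_nonZeroDivisors_of_isField`): `B̄/(h̄) = C/𝔪_A C = 𝒪_{H_y,z}` is a field —
  the fibre `H_y` is reduced (hypothesis) and discrete (`f|_H` is finite), so its local rings are
  fields (`isField_stalk_of_discreteTopology`) — hence `(h̄)` is the maximal ideal of the
  Noetherian local ring `B̄`, of dimension `≥ 1` since `x` is a closed point of a fibre all of
  whose components are curves (`one_le_ringKrullDim_stalk_of_mem_irreducibleComponents`), and a
  principal maximal ideal of a local ring of positive dimension is generated by a
  non-zero-divisor (`mem_nonZeroDivisors_of_maximalIdeal_eq_span`, Krull's intersection theorem).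
  So `C = B/(h)` is flat over `A` by the slicing criterion (`flat_stalkMap_subschemeι_comp`).
* **unramified.** `𝔪_A C` is the maximal ideal of `C` (`C/𝔪_A C` is a field) and `κ(z)/κ(y)` is
  finite (`f|_H` finite) over the algebraically closed `κ(y) = k` (`y` closed), hence separable;
  so `A → C` is formally unramified (`formallyUnramified_stalkMap_of_isField`, Mathlib
  `Algebra.FormallyUnramified.of_map_maximalIdeal`).
* **étale nearby.** Flat and unramified at `z` ⇒ étale on an open neighbourhood of `z`
  (`exists_etale_ι_comp_of_flat_of_formallyUnramified_stalkMap`, EGA IV₄ 17.6.1 c)⇒a),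
  `EtaleNhdOfFlatUnramifiedPoint.lean`), and `f|_H` being closed, étale over an open
  neighbourhood of `y` (`exists_etale_morphismRestrict_of_forall_exists_opens`, `EtaleOverNhd.lean`).

Results: **`DeJong1996MultisectionEtaleNhd_holds`**, and the local step / Lemma 4.13 / Thm. 4.1
from the hyperplane-section input alone (`DeJong1996MultisectionLocal.of_hyperplane`,
`DeJong1996MultisectionLemma.of_hyperplane`,
`DeJong1996StrongAlgClosed.of_fibration_hyperplane_toSemiStablePair_resolution`,
`DeJong1996Strong.of_descent_fibration_hyperplane_toSemiStablePair_resolution`).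

## Sources

* A. J. de Jong, *Smoothness, semi-stability and alterations*, Publ. Math. IHÉS 83 (1996) 51–93:
  Lemma 4.13 and its proof, pp. 69–70. [DeJong1996]
* A. Grothendieck, J. Dieudonné, *EGA IV₃*, Publ. Math. IHÉS 28 (1966), Thm. 11.3.8. [EGAIV3]
* A. Grothendieck, J. Dieudonné, *EGA IV₄*, Publ. Math. IHÉS 32 (1967), Thm. 17.6.1.
  [Grothendieck1967]
* H. Matsumura, *Commutative Ring Theory* (1986), §22, Corollary to Thm. 22.5. [Matsumura1987]
-/

noncomputable section

open CategoryTheory CategoryTheory.Limits AlgebraicGeometry TopologicalSpace Topology IsLocalRing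

namespace Literature.AlgebraicGeometry.Resolution

universe u

/-! ## The assembly -/

/-- **de Jong 1996, proof of Lemma 4.13: `f|_H` is étale over a neighbourhood of `y`** — the
named fact `DeJong1996MultisectionEtaleNhd`, PROVED: for every point `z` of `H = V(I)` over the
closed point `y`, the stalk map `𝒪_{Y,y} → 𝒪_{H,z}` is flat (slicing criterion along the local
equation `h`, whose image in `𝒪_{X_y,x}` is a non-zero-divisor because `𝒪_{H_y,z}` is a field
and `dim 𝒪_{X_y,x} ≥ 1`) and formally unramified (`𝔪_y𝒪_{H,z} = 𝔪_z`, `κ(z) = κ(y)`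
algebraically closed), hence `f|_H` is étale near `z`; `f|_H` being finite, hence closed, it is
étale over an open neighbourhood of `y`. [cite: DeJong1996, Lemma 4.13 (proof), p. 70] -/
theorem DeJong1996MultisectionEtaleNhd_holds : DeJong1996MultisectionEtaleNhd.{u} := by
  intro k _ _ X Y _ _ f _ g hX hY hsurj hgc hdim hdense y hy I hI hfin hsm hred
  haveI := hfin
  haveI : IsProper (f ≫ g) :=
    Literature.AlgebraicGeometry.Motives.IsProjectiveOver.isProper (X := Over.mk (f ≫ g)) hX
  haveI : IsProper g :=
    Literature.AlgebraicGeometry.Motives.IsProjectiveOver.isProper (X := Over.mk g) hY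
  haveI : IsLocallyNoetherian X := LocallyOfFiniteType.isLocallyNoetherian (f ≫ g)
  haveI : IsLocallyNoetherian Y := LocallyOfFiniteType.isLocallyNoetherian g
  refine exists_etale_morphismRestrict_of_forall_exists_opens (I.subschemeι ≫ f) y fun z hz => ?_
  subst hz
  -- the point `x ∈ H ∩ f⁻¹(y)` of `X` under `z`, a smooth point of `f`
  have hxH : I.subschemeι z ∈ (I.support : Set X) := by
    rw [← Scheme.IdealSheafData.range_subschemeι]
    exact ⟨z, rfl⟩
  have hxsm : I.subschemeι z ∈ f.smoothLocus := hsm ⟨hxH, rfl⟩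
  have hflx : (f.stalkMap (I.subschemeι z)).hom.Flat := flat_stalkMap_of_mem_smoothLocus f hxsm
  -- a local equation `h` of `H` at `x`
  obtain ⟨U, hxU, f₀, -, hIU⟩ := hI (I.subschemeι z)
  have hIx : stalkIdeal I (I.subschemeι z) =
      Ideal.span {(X.presheaf.germ U (I.subschemeι z) hxU).hom f₀} := by
    rw [stalkIdeal_eq_map_germ I U hxU, hIU, Ideal.map_span, Set.image_singleton]
  -- `𝒪_{H_y,z} = 𝒪_{H,z}/𝔪_y𝒪_{H,z}` is a field: `H_y` is reduced and discrete
  have hF : IsField (I.subscheme.presheaf.stalk z ⧸ (maximalIdeal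
      (Y.presheaf.stalk ((I.subschemeι ≫ f) z))).map ((I.subschemeι ≫ f).stalkMap z).hom) := by
    obtain ⟨e⟩ := Literature.AlgebraicGeometry.Motives.nonempty_stalkFiber_ringEquiv_asFiber
      (I.subschemeι ≫ f) z
    haveI := hred
    exact MulEquiv.isField
      (isField_stalk_of_discreteTopology ((I.subschemeι ≫ f).asFiber z)) e.symm.toMulEquiv
  -- `dim 𝒪_{X_y,x} ≥ 1`: `x` is a closed point of a fibre whose components are curves
  have hzc : IsClosed ({z} : Set ↥I.subscheme) :=
    isClosed_singleton_of_apply_eq (I.subschemeι ≫ f) hy rfl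
  have hxc : IsClosed ({I.subschemeι z} : Set X) := by
    rw [← Set.image_singleton]
    exact I.subschemeι.isClosedEmbedding.isClosedMap _ hzc
  have hx'c : IsClosed ({f.asFiber (I.subschemeι z)} : Set ↥(f.fiber (f (I.subschemeι z)))) := by
    have e : ({f.asFiber (I.subschemeι z)} : Set ↥(f.fiber (f (I.subschemeι z)))) =
        f.fiberι (f (I.subschemeι z)) ⁻¹' {I.subschemeι z} := by
      ext w
      simp only [Set.mem_singleton_iff, Set.mem_preimage]
      constructor
      · rintro rfl
        exact f.fiberι_asFiber _
      · intro hw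
        apply (f.fiberι (f (I.subschemeι z))).isEmbedding.injective
        rw [hw, f.fiberι_asFiber]
    rw [e]
    exact hxc.preimage (f.fiberι _).continuous
  have hdimB : 1 ≤ ringKrullDim (X.presheaf.stalk (I.subschemeι z) ⧸
      (maximalIdeal (Y.presheaf.stalk (f (I.subschemeι z)))).map
        (f.stalkMap (I.subschemeι z)).hom) := by
    obtain ⟨e⟩ := Literature.AlgebraicGeometry.Motives.nonempty_stalkFiber_ringEquiv_asFiber
      f (I.subschemeι z)
    rw [← ringKrullDim_eq_of_ringEquiv e]
    exact one_le_ringKrullDim_stalk_of_mem_irreducibleComponents hx'c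
      (irreducibleComponent_mem_irreducibleComponents _) mem_irreducibleComponent
      (hdim _ _ (irreducibleComponent_mem_irreducibleComponents _))
  -- the image of `h` in `𝒪_{X_y,x}` is a non-zero-divisor
  have hψ : ((I.subschemeι ≫ f).stalkMap z).hom =
      (I.subschemeι.stalkMap z).hom.comp (f.stalkMap (I.subschemeι z)).hom := by
    rw [Scheme.Hom.stalkMap_comp]
    rfl
  have hker : RingHom.ker (I.subschemeι.stalkMap z).hom =
      Ideal.span {(X.presheaf.germ U (I.subschemeι z) hxU).hom f₀} := by
    rw [← hIx, ← stalkIdeal_ker_eq_ker_stalkMap I.subschemeι z,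
      Scheme.IdealSheafData.ker_subschemeι]
  have hreg := quotient_mk_mem_nonZeroDivisors_of_isField
    ((maximalIdeal (Y.presheaf.stalk (f (I.subschemeι z)))).map (f.stalkMap (I.subschemeι z)).hom)
    (I.subschemeι.stalkMap z).hom (I.subschemeι.stalkMap_surjective z) hker
    (by rw [Ideal.map_map, ← hψ]; exact hF) hdimB
  -- flat and unramified at `z`
  have hflz : ((I.subschemeι ≫ f).stalkMap z).hom.Flat :=
    flat_stalkMap_subschemeι_comp f I z hflx hIx hreg
  haveI : IsAlgClosed (Y.residueField ((I.subschemeι ≫ f) z)) :=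
    isAlgClosed_residueField_of_isClosed g hy
  have hur : ((I.subschemeι ≫ f).stalkMap z).hom.FormallyUnramified := by
    refine formallyUnramified_stalkMap_of_isField (I.subschemeι ≫ f) z hF ?_
    letI : Algebra (Y.residueField ((I.subschemeι ≫ f) z)) (I.subscheme.residueField z) :=
      ((I.subschemeι ≫ f).residueFieldMap z).hom.toAlgebra
    haveI : Module.Finite (Y.residueField ((I.subschemeι ≫ f) z)) (I.subscheme.residueField z) :=
      Scheme.Hom.finite_residueField_of_isFinite (I.subschemeι ≫ f) z
    exact Algebra.IsAlgebraic.isSeparable_of_perfectField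
  exact exists_etale_ι_comp_of_flat_of_formallyUnramified_stalkMap (I.subschemeι ≫ f) z hflz hur

/-! ## Downstream: Lemma 4.13 and Thm. 4.1 from the hyperplane section alone -/

/-- The local step of Lemma 4.13 (`DeJong1996MultisectionLocal`) from its one remaining named
input, the hyperplane section `DeJong1996MultisectionHyperplane`.
[cite: DeJong1996, Lemma 4.13 (proof), pp. 69–70] -/
theorem DeJong1996MultisectionLocal.of_hyperplane (hA : DeJong1996MultisectionHyperplane.{u}) :
    DeJong1996MultisectionLocal.{u} :=
  DeJong1996MultisectionLocal.of_hyperplane_of_etaleNhd hA DeJong1996MultisectionEtaleNhd_holds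

/-- Lemma 4.13 (`DeJong1996MultisectionLemma`) from the hyperplane section.
[cite: DeJong1996, Lemma 4.13, pp. 69–70] -/
theorem DeJong1996MultisectionLemma.of_hyperplane (hA : DeJong1996MultisectionHyperplane.{u}) :
    DeJong1996MultisectionLemma.{u} :=
  DeJong1996MultisectionLemma.of_local (DeJong1996MultisectionLocal.of_hyperplane hA)

/-- Thm. 4.1 with its generically-étale clause over algebraically closed fields
(`DeJong1996StrongAlgClosed`) from 4.11–4.12, the hyperplane section of Lemma 4.13, 4.15–4.22
and 4.23–4.28. [cite: DeJong1996, 4.3–4.28, pp. 66–76] -/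
theorem DeJong1996StrongAlgClosed.of_fibration_hyperplane_toSemiStablePair_resolution
    (h₁ : DeJong1996FibrationReduction.{u}) (hA : DeJong1996MultisectionHyperplane.{u})
    (h15 : DeJong1996MultisectionToSemiStablePair.{u})
    (hres : DeJong1996SemiStablePairResolution.{u}) : DeJong1996StrongAlgClosed.{u} :=
  DeJong1996StrongAlgClosed.of_fibration_multisectionLocal_toSemiStablePair_resolution h₁
    (DeJong1996MultisectionLocal.of_hyperplane hA) h15 hres

/-- Thm. 4.1 (i)+(ii) over every field from 4.5 (`DeJong1996Descent`), 4.11–4.12, the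
hyperplane section of Lemma 4.13, 4.15–4.22 and 4.23–4.28.
[cite: DeJong1996, 4.3–4.28, pp. 66–76] -/
theorem DeJong1996Strong.of_descent_fibration_hyperplane_toSemiStablePair_resolution
    (h45 : DeJong1996Descent.{u}) (h₁ : DeJong1996FibrationReduction.{u})
    (hA : DeJong1996MultisectionHyperplane.{u}) (h15 : DeJong1996MultisectionToSemiStablePair.{u})
    (hres : DeJong1996SemiStablePairResolution.{u}) : DeJong1996Strong.{u} :=
  DeJong1996Strong.of_descent_fibration_multisectionLocal_toSemiStablePair_resolution h45 h₁
    (DeJong1996MultisectionLocal.of_hyperplane hA) h15 hres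

end Literature.AlgebraicGeometry.Resolution

end
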